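import Summits.Ventures.WeilGRH.UniformConductorFloorLog8HalfTableValidA
import Summits.Ventures.WeilGRH.UniformConductorFloorAopFloors
import HarnessLib

/-!
# GRH arm (rh-explicit, venture WeilGRH): the prime-constant floors of the window of `Log8HalfTable` (`floors_log8half`) — split off gen9's validity part A

Cell `rh-explicit`, WEIL TRACK — GRH ARM (weil-grh-1 gen10 re-cut of gen9's `UniformConductorFloorLog8HalfTableValidA.lean`).  The floors `⌊2a/log k⌋` on the window's
prime powers by integer comparison (`TwistedEncl.floor_two_mul_halfLog_div`, `UniformConductorFloorAopFloors.lean`) — the `hfl` input of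
`TwistedEncl.mem_aopBoxW_of_floors` for the door cells at this window (needed where a floor sits at an exact integer, e.g. `2a/log 2 = 3` at `(log 8)/2`,
`2a/log 3 = 2` at `log 3`, which the interval test `checkFloors` cannot certify).  One theorem; no definitions; standard axioms. [folklore]
-/

namespace Summit.Ventures.WeilGRH.Log8HalfTable
open Literature.NumberTheory.LFunctions Literature.NumberTheory.LFunctions.Yoshida1992 Encl Literature.Analysis.ValidatedNumerics.NumericsMP

/-- The prime-constant floors of the window `a = (log 8)/2` on the prime powers `2, 3, 4, 5, 7`: `⌊2a/ℓ⌋ = [3, 1, 1, 1, 1]` (`log 8/log 2 = 3` EXACT, so by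
integer comparison `p^{e n} ≤ 8 < p^{e (n+1)}`, not by intervals) — the `hfl` input of `TwistedEncl.mem_aopBoxW_of_floors` for every door cell at this window. [folklore] -/
theorem floors_log8half : ∀ i < ks.length, ⌊2 * a / (ks.getD i default).len⌋₊ = [3, 1, 1, 1, 1].getD i 0 := by
  intro i hi
  have hi5 : i < 5 := by simpa [ks] using hi
  unfold a PrimeLen.len
  interval_cases i
  · simpa [ks] using TwistedEncl.floor_two_mul_halfLog_div (p := 2) (e := 1) (n := 3) (b := 8) (by norm_num) (by norm_num) (by norm_num) (by norm_num) (by norm_num)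
  · simpa [ks] using TwistedEncl.floor_two_mul_halfLog_div (p := 3) (e := 1) (n := 1) (b := 8) (by norm_num) (by norm_num) (by norm_num) (by norm_num) (by norm_num)
  · simpa [ks] using TwistedEncl.floor_two_mul_halfLog_div (p := 2) (e := 2) (n := 1) (b := 8) (by norm_num) (by norm_num) (by norm_num) (by norm_num) (by norm_num)
  · simpa [ks] using TwistedEncl.floor_two_mul_halfLog_div (p := 5) (e := 1) (n := 1) (b := 8) (by norm_num) (by norm_num) (by norm_num) (by norm_num) (by norm_num)
  · simpa [ks] using TwistedEncl.floor_two_mul_halfLog_div (p := 7) (e := 1) (n := 1) (b := 8) (by norm_num) (by norm_num) (by norm_num) (by norm_num) (by norm_num)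

end Summit.Ventures.WeilGRH.Log8HalfTable
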